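import Mathlib

set_option linter.dupNamespace false

/-!
# Stub `stub_cosetTiles` — the A–C layer of a coset design is exact

Crux `stmt-MatrixMultiplication-10595` (`Theses.ThinBlockAlpha.ThinPackings`), line
`log-flat-cyclic-designs`.

Data: a field `F` with an algebra structure over `ZMod p` (`p : ℕ` arbitrary, primality is never used),
an element `ζ : F` that is quadratic over the scalars (`ζ * ζ = u + v ζ`), base points
`x i = s i + (g i + h i ζ)` of the blocks, where the four vectors `1, ζ, s i, ζ s i` are
`ZMod p`-independent, the six vectors `1, ζ, s i, ζ s i, s k, ζ s k` are independent whenever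
`s i ≠ s k`, and `i ↦ (s i, g i, h i)` is injective.  Block `i` has the two long legs
`A i = x i + 𝔽_p^×` and `C i = x i + ζ 𝔽_p^×`.

Claim (`stub_cosetTiles`): a tile collision `(x i + τ') (x k + ζ ρ') = (x k + τ) (x i + ζ ρ)` with all four
box variables `τ, τ', ρ, ρ'` nonzero forces `i = k`, `τ = τ'`, `ρ = ρ'`.

Proof.  Subtracting `x i * x k` from both sides, the collision identity is the `ZMod p`-LINEAR relation
`x i (ζ ρ' − τ) + x k (τ' − ζ ρ) + ζ (τ' ρ' − τ ρ) = 0`; substituting `x i = s i + g i + h i ζ` and reducing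
`ζ²` with `ζ * ζ = u + v ζ`, it is a linear relation on `1, ζ, s i, ζ s i, s k, ζ s k` whose coefficients on
`s i, ζ s i, s k, ζ s k` are `−τ, ρ', τ', −ρ`.
* If `s i ≠ s k`, independence of the six vectors gives `τ = 0`, a contradiction.
* If `s i = s k`, the relation lives on `1, ζ, s i, ζ s i` with coefficients `τ' − τ` on `s i` and `ρ' − ρ`
  on `ζ s i`, so `τ' = τ` and `ρ' = ρ`.  The collision then factors in the field `F` as
  `(γ i − γ k) (ζ ρ − τ) = 0` with `γ i = g i + h i ζ`; the second factor is nonzero (else `ρ ζ − τ 1 = 0`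
  would be a nontrivial relation on `1, ζ`), so `γ i = γ k`, whence `g i = g k` and `h i = h k` by
  independence of `1, ζ`, and injectivity gives `i = k`.
-/

namespace Summit.MatrixMultiplication.MatrixMultiplication.Theorems.ThinPackings

section Helpers

variable {R M : Type*} [CommRing R] [AddCommGroup M] [Module R M]

/-- Reading off the coefficients of a vanishing linear combination of a linearly independent
family of four vectors. -/
private theorem linIndep_four_coeffs {a b c d : M} (hli : LinearIndependent R ![a, b, c, d])
    (c₀ c₁ c₂ c₃ : R) (h0 : c₀ • a + c₁ • b + c₂ • c + c₃ • d = 0) :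
    c₀ = 0 ∧ c₁ = 0 ∧ c₂ = 0 ∧ c₃ = 0 := by
  have key := Fintype.linearIndependent_iff.mp hli ![c₀, c₁, c₂, c₃]
    (by simpa [Fin.sum_univ_four] using h0)
  exact ⟨key 0, key 1, key 2, key 3⟩

/-- Reading off the coefficients of a vanishing linear combination of a linearly independent
family of six vectors. -/
private theorem linIndep_six_coeffs {a b c d e f : M}
    (hli : LinearIndependent R ![a, b, c, d, e, f]) (c₀ c₁ c₂ c₃ c₄ c₅ : R)
    (h0 : c₀ • a + c₁ • b + c₂ • c + c₃ • d + c₄ • e + c₅ • f = 0) :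
    c₀ = 0 ∧ c₁ = 0 ∧ c₂ = 0 ∧ c₃ = 0 ∧ c₄ = 0 ∧ c₅ = 0 := by
  have key := Fintype.linearIndependent_iff.mp hli ![c₀, c₁, c₂, c₃, c₄, c₅]
    (by simpa [Fin.sum_univ_six] using h0)
  exact ⟨key 0, key 1, key 2, key 3, key 4, key 5⟩

end Helpers

/-- **The A–C layer of a coset design is exact** (stub `stub_cosetTiles` of the line
`log-flat-cyclic-designs`).  With `ζ` quadratic over `ZMod p` (`ζ * ζ = u + v ζ`), base points
`x i = s i + (g i + h i ζ)` such that `1, ζ, s i, ζ s i` are independent, `1, ζ, s i, ζ s i, s k, ζ s k` are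
independent whenever `s i ≠ s k`, and `i ↦ (s i, g i, h i)` injective, a tile collision
`(x i + τ') (x k + ζ ρ') = (x k + τ) (x i + ζ ρ)` with nonzero box variables forces `i = k`, `τ = τ'` and
`ρ = ρ'`. -/
theorem stub_cosetTiles :
    ∀ (p : ℕ) (F : Type) [Field F] [Algebra (ZMod p) F] (ζ : F) (u v : ZMod p),
      ζ * ζ = algebraMap (ZMod p) F u + algebraMap (ZMod p) F v * ζ →
      ∀ (L : ℕ) (s : Fin L → F) (g h : Fin L → ZMod p),
        (∀ i, LinearIndependent (ZMod p) ![(1 : F), ζ, s i, ζ * s i]) →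
        (∀ i k, s i ≠ s k → LinearIndependent (ZMod p) ![(1 : F), ζ, s i, ζ * s i, s k, ζ * s k]) →
        (∀ i k, s i = s k → g i = g k → h i = h k → i = k) →
        ∀ (i k : Fin L) (τ τ' ρ ρ' : ZMod p), τ ≠ 0 → τ' ≠ 0 → ρ ≠ 0 → ρ' ≠ 0 →
          (s i + (algebraMap (ZMod p) F (g i) + algebraMap (ZMod p) F (h i) * ζ) + algebraMap (ZMod p) F τ') *
              (s k + (algebraMap (ZMod p) F (g k) + algebraMap (ZMod p) F (h k) * ζ) +
                ζ * algebraMap (ZMod p) F ρ') =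
            (s k + (algebraMap (ZMod p) F (g k) + algebraMap (ZMod p) F (h k) * ζ) + algebraMap (ZMod p) F τ) *
              (s i + (algebraMap (ZMod p) F (g i) + algebraMap (ZMod p) F (h i) * ζ) +
                ζ * algebraMap (ZMod p) F ρ) →
          i = k ∧ τ = τ' ∧ ρ = ρ' := by
  intro p F _ _ ζ u v hζ L s g h hind4 hind6 hinj i k τ τ' ρ ρ' hτ hτ' hρ hρ' hE
  by_cases hs : s i = s k
  · -- Case `s i = s k`: the collision is a relation on the four vectors `1, ζ, s i, ζ * s i`.
    rw [← hs] at hE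
    obtain ⟨-, -, h2, h3⟩ := linIndep_four_coeffs (hind4 i)
      (-(g i * τ) + h i * ρ' * u + g k * τ' - h k * ρ * u)
      (g i * ρ' + h i * ρ' * v - h i * τ - g k * ρ + h k * τ' - h k * ρ * v + τ' * ρ' - τ * ρ)
      (τ' - τ) (ρ' - ρ) (by
        simp only [Algebra.smul_def, map_add, map_mul, map_sub, map_neg]
        linear_combination hE +
          (algebraMap (ZMod p) F (h k) * algebraMap (ZMod p) F ρ -
            algebraMap (ZMod p) F (h i) * algebraMap (ZMod p) F ρ') * hζ)
    have hτeq : τ' = τ := sub_eq_zero.mp h2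
    have hρeq : ρ' = ρ := sub_eq_zero.mp h3
    refine ⟨?_, hτeq.symm, hρeq.symm⟩
    rw [hτeq, hρeq] at hE
    -- The collision now factors in the field `F`.
    have hprod :
        (algebraMap (ZMod p) F (g i) + algebraMap (ZMod p) F (h i) * ζ -
            (algebraMap (ZMod p) F (g k) + algebraMap (ZMod p) F (h k) * ζ)) *
          (ζ * algebraMap (ZMod p) F ρ - algebraMap (ZMod p) F τ) = 0 := by
      linear_combination hE
    rcases mul_eq_zero.mp hprod with h1 | h1
    · -- `γ i = γ k`: read off the coefficients on `1, ζ`.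
      obtain ⟨hg, hh, -, -⟩ := linIndep_four_coeffs (hind4 i) (g i - g k) (h i - h k) 0 0 (by
        simp only [Algebra.smul_def, map_sub, map_zero]
        linear_combination h1)
      exact hinj i k hs (sub_eq_zero.mp hg) (sub_eq_zero.mp hh)
    · -- `ζ ρ = τ` would be a nontrivial relation on `1, ζ`.
      obtain ⟨-, hρ0, -, -⟩ := linIndep_four_coeffs (hind4 i) (-τ) ρ 0 0 (by
        simp only [Algebra.smul_def, map_neg, map_zero]
        linear_combination h1)
      exact absurd hρ0 hρ
  · -- Case `s i ≠ s k`: the coefficient of `s i` in the six-vector relation is `-τ ≠ 0`.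
    obtain ⟨-, -, h2, -, -, -⟩ := linIndep_six_coeffs (hind6 i k hs)
      (-(g i * τ) + h i * ρ' * u + g k * τ' - h k * ρ * u)
      (g i * ρ' + h i * ρ' * v - h i * τ - g k * ρ + h k * τ' - h k * ρ * v + τ' * ρ' - τ * ρ)
      (-τ) ρ' τ' (-ρ) (by
        simp only [Algebra.smul_def, map_add, map_mul, map_sub, map_neg]
        linear_combination hE +
          (algebraMap (ZMod p) F (h k) * algebraMap (ZMod p) F ρ -
            algebraMap (ZMod p) F (h i) * algebraMap (ZMod p) F ρ') * hζ)
    exact absurd (neg_eq_zero.mp h2) hτ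

end Summit.MatrixMultiplication.MatrixMultiplication.Theorems.ThinPackings
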